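import Literature.Topology.FourManifolds.SphereTubeOfFraming
import Literature.Topology.FourManifolds.InteriorSmoothEmbedding
import HarnessLib

/-!
# Framed tubes along normally framed spheres in the interior of a manifold with boundary

Topic `Literature/Topology/FourManifolds` (infrastructure for the fact seat of
`Literature.Topology.FourManifolds.HomotopySphere.exists_highlyConnected_of_mem_signatureSet`,
brick B8-T∂: the tubular-neighbourhood step of Kosinski X.(2.1) in the form consumed by
`NullCobordism.surgery`).  A normally framed embedded `k`-sphere in the INTERIOR of a `C^∞`
manifold `W` with boundary (dimension `n + 1 = k + m`) is the core of a framed sphere family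
`Sᵏ × ℝᵐ ↪ W` for the half-space model `𝓡∂ (n + 1)` (Kosinski 1993, III Cor. (2.3) with
X.(2.1), p. 200: "`φ` imbeds `Sᵏ × Dᵐ` in `Int W`"): the tube is built in the boundaryless
interior (`exists_isSmoothEmbedding_tube_of_isSmoothAlong`) and pushed into `W` along the
inclusion of the interior (`InteriorManifold.isSmoothEmbedding_val_comp`).

* `exists_framedSphereFamily_halfSpace_of_isSmoothAlong`.

Everything is proved; no definitions, no named facts.

## References

* A. Kosinski, *Differential Manifolds* (1993), III §2, Cor. (2.3); X §2, Lemma (2.1), p. 200.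
  [Kosinski1993]
-/

open scoped Manifold ContDiff Topology
open Set Function

noncomputable section

namespace Literature.Topology.FourManifolds

universe u

/-- **A normally framed embedded sphere in the interior of a manifold with boundary is the core
of a framed sphere family** `Sᵏ × ℝᵐ ↪ W` (model `𝓡∂ (n + 1)`), Kosinski 1993, III Cor. (2.3)
and X.(2.1): given `c : Sᵏ → Int W` smooth and injective and linear maps
`N u : ℝᵐ →L T_{c u} W` smooth along `c` with `dc_u ⊕ N u` bijective, there is
`ν : FramedSphereFamily (𝓡∂ (n+1)) W Unit k m` with `ν (u, 0) = c u`.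
[cite: Kosinski1993, Ch. III §2, Cor. (2.3); Ch. X §2, Lemma (2.1), p. 200] -/
theorem exists_framedSphereFamily_halfSpace_of_isSmoothAlong {n k m : ℕ}
    {W : Type u} [TopologicalSpace W] [T2Space W] [ChartedSpace (EuclideanHalfSpace (n + 1)) W]
    [IsManifold (𝓡∂ (n + 1)) ∞ W]
    {c : Metric.sphere (0 : EuclideanSpace ℝ (Fin (k + 1))) 1 → InteriorManifold (𝓡∂ (n + 1)) W}
    (hc : ContMDiff (𝓡 k) 𝓘(ℝ, EuclideanSpace ℝ (Fin (n + 1))) ∞ c) (hci : Injective c)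
    {N : Metric.sphere (0 : EuclideanSpace ℝ (Fin (k + 1))) 1 →
      (EuclideanSpace ℝ (Fin m) →L[ℝ] EuclideanSpace ℝ (Fin (n + 1)))}
    (hN : IsSmoothAlong (𝓡 k) c N)
    (hbij : ∀ u, Bijective
      ((mfderiv (𝓡 k) 𝓘(ℝ, EuclideanSpace ℝ (Fin (n + 1))) c u).coprod (N u))) :
    ∃ ν : FramedSphereFamily (𝓡∂ (n + 1)) W Unit k m, ∀ u, ν.toFun () (u, 0) = (c u).val := by
  haveI : Nonempty (Metric.sphere (0 : EuclideanSpace ℝ (Fin (k + 1))) 1) :=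
    ⟨⟨EuclideanSpace.single 0 1, by simp⟩⟩
  obtain ⟨u₀⟩ := ‹Nonempty (Metric.sphere (0 : EuclideanSpace ℝ (Fin (k + 1))) 1)›
  -- the linear model `ℝᵏ × ℝᵐ ≃L ℝⁿ⁺¹`
  let L : (EuclideanSpace ℝ (Fin k) × EuclideanSpace ℝ (Fin m)) ≃L[ℝ] EuclideanSpace ℝ (Fin (n + 1)) :=
    (LinearEquiv.ofBijective
      (show (EuclideanSpace ℝ (Fin k) × EuclideanSpace ℝ (Fin m)) →ₗ[ℝ]
          EuclideanSpace ℝ (Fin (n + 1)) from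
        ((mfderiv (𝓡 k) 𝓘(ℝ, EuclideanSpace ℝ (Fin (n + 1))) c u₀).coprod (N u₀)).toLinearMap)
      (by exact hbij u₀)).toContinuousLinearEquiv
  -- the tube in the interior
  obtain ⟨ν, hν, hνo, hν0⟩ := exists_isSmoothEmbedding_tube_of_isSmoothAlong
    (IM := 𝓡 k) (F := EuclideanSpace ℝ (Fin m)) hc hci hN hbij
  -- pushed into `W`
  have hν' := InteriorManifold.isSmoothEmbedding_val_comp hν hνo L
  exact ⟨{ toFun := fun _ => InteriorManifold.val ∘ ν
           isSmoothEmbedding := fun _ => hν'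
           isOpen_range := fun _ => InteriorManifold.isOpen_range_val_comp hνo
           disjoint_range := fun i j hij => absurd (Subsingleton.elim i j) hij },
    fun u => by simp only [comp_apply, hν0]⟩

end Literature.Topology.FourManifolds
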